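import Literature.NumberTheory.DiophantineGeometry.BcgpSwitchExistsModularAbelianSurface
import Literature.AlgebraicGeometry.Motives.GoodReduction
import HarnessLib

/-!
# Boxer–Calegari–Gee–Pilloni 2025, Theorem 9.5.5 ("a question of Drew Sutherland"):
# surjective mod-`3` image, `ρ̄_{A,3}` unramified at `2`, BAD reduction at `2`, good ordinary and
# `3`-distinguished at `3` ⇒ modular

Topic `Literature/NumberTheory/DiophantineGeometry`, sibling of
`Bcgp2025ModThreeSurjectiveModular.lean` (the main theorem, Theorem A) whose clause shapes it
repeats VERBATIM. ONE named fact (D-0014), no proof, no new definition: Theorem 9.5.5 (the fifth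
Theorem of §9.5) of G. Boxer, F. Calegari, T. Gee, V. Pilloni, *Modularity theorems for abelian
surfaces*, arXiv:2502.20645 (2025) (TeX label `drew`; chunk p0137 L89–107 of the held arXiv TeX
rendering `paper:arxiv-2502.20645` — a chunk id, not a PDF page; numbering verified against the
arXiv v1 source counters / HTML render, `lit/LIT2-RESIDUAL-MODULARITY.md` §8), in the
CASE OF SURJECTIVE IMAGE `ρ̄_{A,3}(G_ℚ) = GSp₄(𝔽₃)` — the case the venture cell `pub-residmod`
certifies (its census reproduces the source's count "359 [LMFDB curves with bad reduction at 2]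
are 3-distinguished and thus modular by Theorem [9.5.5]", §10.1); see
`run/shared/lean/pub/pub-residmod/lit/BCGP-AS-PRINTED.md`, §B2/§B4.

## The printed statement

Theorem 9.5.5, verbatim: "Let `A/ℚ` be an abelian surface with a polarization of degree
prime to `3`. Suppose the following holds: (1) The image of the mod `3` representation
`ρ̄_{A,3} : Gal(ℚ̄/ℚ) → GSp₄(𝔽₃)` is one of the `15` subgroups listed in Lemma [6.4.3], and
`End(A_ℚ̄) = ℤ`. (2) `ρ̄_{A,3}|_{G_{ℚ₂}}` is unramified. (3) `A` has
good ordinary reduction at `3` and the characteristic polynomial of Frobenius at `3` does not have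
repeated roots. (4) `A` has bad reduction at `2`. Then `A` is modular."  Its printed proof: "We
shall apply Theorem [9.5.2]. It suffices to show that, under the assumption that
`A` has bad reduction at `2`, that the action of `Frob₂` on `A[3]` does not have characteristic
polynomial `(x² ± x + 2)²`" (semistable reduction by Grothendieck, a `G_{ℚ₂}`-stable filtration of
`T₃`, and for purely multiplicative reduction the descent datum in `GL₂(ℤ)` has order `≤ 6` while
`x⁴ + 1 = (x² + x + 2)(x² − x + 2) mod 3` would force order divisible by `8`).  The preceding
sentence of the source (chunk p0137 L82–88): "Note that Theorem [A] and Theorem [9.5.2] do not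
require that `A` has good reduction at `2`, only that `ρ̄_{A,3}` is unramified at `2`. Here
we answer a question of Drew Sutherland, who asks if the conditions of our main theorem are easy
to verify computationally if `ℚ(A[3])` is unramified at `2` but `A` has bad reduction at `2`."

SPECIALISATION recorded here: hypothesis (1) is taken in the case `im ρ̄_{A,3} = GSp₄(𝔽₃)`. This
IS one of the 15 subgroups (Lemma 6.4.3: "In particular, these conditions are all satisfied if
`ρ̄(G_ℚ) = GSp₄(𝔽₃)`"; last row of Table 6.4.4, label 1.1.1), and then "`End(A_ℚ̄) = ℤ` is
automatic" (§9.5, chunk p0136 L19–23: "if `ρ̄_{A,3}` is surjective, then `End(A_ℚ̄) = ℤ` is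
automatic, so Theorem [9.5.2] really does imply Theorem [A]").  So the typed statement is the printed theorem
restricted to a printed sub-case — weaker than print, never stronger.  The general form (the 15
subgroups: Table 6.4.4, LMFDB labels 3.1620.1, 3.1620.5, 3.1620.10, 3.1296.1, 3.810.2, 3.810.6,
3.540.1, 3.405.1, 3.270.1, 3.216.1, 3.135.1, 3.135.2, 3.45.1, 3.27.1, 1.1.1) waits for explicit generators
of those classes and for Whitmore's "`GSp₄`-reasonable".

## Rendering (clause by clause; identical to the sibling except (2) and (4))

HYPOTHESES on `A : AbelianVariety ℚ`, `A.dim = 2`, a torsion frame `(ρ₀, e)` of `A[3](ℚ̄)` and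
`ρb = ρ₀^∨ = FramedRep.dual ρ₀` (the representation on `H¹(A_ℚ̄, 𝔽₃)`, the paper's `ρ̄_{A,3}`):
* (0)+(1) as in the sibling: an invertible alternating `J ∈ M₄(𝔽₃)` with
  `ρb(σ)ᵀ J ρb(σ) = ε̄(σ)⁻¹ J` (what "a polarization of degree prime to `3`" is used for, §1.8.23)
  and `ρb(Γ_ℚ) = GSp(J)(𝔽₃)` (surjectivity; §1.8.23).
* (2) `ρb` is unramified at the place above `2` (`FramedGaloisRep.IsUnramifiedAt`) — NO condition
  on `Frob₂`.
* (3a) `A.HasGoodOrdinaryReductionAt v` for `v ∣ 3`; (3b) for every prime `ℓ ≠ 3` the framed dual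
  `r` of `V_ℓ(A)` is unramified at `v ∣ 3` with separable Frobenius characteristic polynomial
  ("does not have repeated roots"; Definition 9.1.2), exactly as in the sibling.
* (4) "`A` has bad reduction at `2`": NOT `HasGoodReductionAt A.X A.dim v` for `v ∣ 2` — the
  underlying variety has no smooth proper model over `ℤ_{(2)}` (tree
  `Literature.AlgebraicGeometry.Motives.HasGoodReductionAt`, Serre–Tate §1; for an abelian variety a
  smooth proper model is an abelian scheme — Mumford, GIT Thm. 6.14 — so this is bad reduction of
  the abelian variety; `HasGoodOrdinaryReductionAt.hasGoodReductionAt` is the tree's bridge in the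
  other direction).
CONCLUSION: verbatim the `GL₄` almost-everywhere clause of
`bcgp_residuallyA5b_modular_abelianSurface` / the sibling.

## Status

Conditional in print on the twisted weighted fundamental lemma (§1.6 of the source, quoted in the
sibling's docstring); Magma computations behind §9.1–§9.2 and §6.4.  Consumed as an explicit
hypothesis `(h : bcgp2025_modThreeSurjective_badAtTwo_modular_abelianSurface)`.  SIZE XL to
discharge (it is the main theorem plus a local argument at `2`).

## References

* [BoxerCalegariGeePilloni2025] G. Boxer, F. Calegari, T. Gee, V. Pilloni, *Modularity theorems
  for abelian surfaces*, arXiv:2502.20645 (2025): Theorem 9.5.5 (label `drew`) and its proof,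
  Remark 9.5.6; Theorem 9.5.2; Lemma 6.4.3 / Table 6.4.4; §1.8.23; §1.8.24 Definition 1.8.25;
  Definition 9.1.2; §10.1 ("359").
* [Gee2026] T. Gee, *Modularity theorems for abelian surfaces*, ICM 2026 (arXiv:2510.02756), §1.
* [SerreTate1968] J.-P. Serre, J. Tate, *Good reduction of abelian varieties*, Ann. of Math. 88
  (1968), §1 (good reduction = abelian-scheme model).
* [MumfordGIT] D. Mumford, *Geometric invariant theory*, Thm. 6.14 (a smooth proper model of an
  abelian variety with a section is an abelian scheme).
-/

namespace Literature.NumberTheory.DiophantineGeometry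

open CategoryTheory IsDedekindDomain
open scoped NumberField Matrix
open Literature.NumberTheory.GaloisRepresentations Literature.NumberTheory.Automorphic
open Literature.AlgebraicGeometry.Motives (AbelianVariety HasGoodReductionAt)

/-- **Boxer–Calegari–Gee–Pilloni 2025, Theorem 9.5.5 (label `drew`), surjective case**
(`GL₄` almost-everywhere form). Every abelian surface `A/ℚ` (`AbelianVariety ℚ`, `dim A = 2`) such
that, for a torsion frame `(ρ₀, e)` of `A[3](ℚ̄)` and `ρb = ρ₀^∨` (the paper's `ρ̄_{A,3}` on
`H¹(A_ℚ̄, 𝔽₃)`): (0)+(1) `ρb` is symplectic for an invertible alternating `J` with multiplier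
`ε̄⁻¹` and `ρb(Γ_ℚ) = GSp(J)(𝔽₃)` ("polarization of degree prime to `3`" as used in §1.8.23, and
image `= GSp₄(𝔽₃)`, which is one of the 15 subgroups of Lemma 6.4.3 and forces `End(A_ℚ̄) = ℤ`,
§9.5);
(2) `ρb` is unramified at `2`; (3) `A` has good ordinary reduction at `3` and for every `ℓ ≠ 3` the
framed dual of `V_ℓ(A)` is unramified at `3` with separable Frobenius characteristic polynomial
("does not have repeated roots"; Definition 9.1.2); (4) `A` has BAD reduction at `2` (no smooth proper model over
`ℤ_{(2)}`) — is MODULAR: for every prime `p`, every framed dual `r` of `V_p(A)` and every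
`ι : ℚ̄_p ≃ ℂ` there is an L-algebraic cuspidal automorphic representation of `GL₄(𝔸_ℚ)` whose
Satake parameters give `det(X − r(Frob_v))` at all but finitely many `v` (VERBATIM the conclusion
clause of `bcgp_residuallyA5b_modular_abelianSurface`).  Printed theorem restricted to the printed
sub-case `im ρ̄_{A,3} = GSp₄(𝔽₃)`; conditional in print on the twisted weighted fundamental lemma
(§1.6).  Users take `(h : bcgp2025_modThreeSurjective_badAtTwo_modular_abelianSurface)`.  Named
fact (D-0014), not proved in the tree.
[cite: BoxerCalegariGeePilloni2025, Theorem 9.5.5 (label `drew`) with its proof; Theorem 9.5.2; Lemma 6.4.3 ("all satisfied if ρ̄(G_Q) = GSp₄(F₃)"); §9.5 intro ("End(A_Q̄) = Z is automatic"); §1.8.23; §1.8.24 Definition 1.8.25; Definition 9.1.2; §1.6]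
[cite: SerreTate1968, §1 (good reduction)] -/
def bcgp2025_modThreeSurjective_badAtTwo_modular_abelianSurface : Prop :=
  ∀ (A : AbelianVariety ℚ), A.dim = 2 →
    ∀ (ρ₀ : FramedGaloisRep ℚ (ZMod 3) 4) (e : A.geomTorsion (3 : ℕ) ≃+ (Fin 4 → ZMod 3))
      (ρb : FramedGaloisRep ℚ (ZMod 3) 4),
      (∀ (σ : Field.absoluteGaloisGroup ℚ) (P : A.geomTorsion (3 : ℕ)),
        e (σ • P) = ((ρ₀ σ : GL (Fin 4) (ZMod 3)) : Matrix (Fin 4) (Fin 4) (ZMod 3)) *ᵥ e P) →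
      FramedRep.dual ρ₀ = ρb →
    -- (0)+(1): `ρ̄_{A,3}` is `GSp₄`-valued with multiplier `ε̄⁻¹` and SURJECTIVE onto `GSp₄(𝔽₃)`
    (∃ J : Matrix (Fin 4) (Fin 4) (ZMod 3), Jᵀ = -J ∧ IsUnit J.det ∧
      (∀ σ : Field.absoluteGaloisGroup ℚ,
        (ρb σ).valᵀ * J * (ρb σ).val =
          (((modPCyclotomicCharacterZMod ℚ 3 σ)⁻¹ : (ZMod 3)ˣ) : ZMod 3) • J) ∧
      ∀ M : Matrix (Fin 4) (Fin 4) (ZMod 3),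
        (∃ c : (ZMod 3)ˣ, Mᵀ * J * M = (c : ZMod 3) • J) →
          ∃ σ : Field.absoluteGaloisGroup ℚ, (ρb σ).val = M) →
    -- (2): `ρ̄_{A,3}` unramified at `2`
    (∀ v : HeightOneSpectrum (𝓞 ℚ), ((2 : ℕ) : 𝓞 ℚ) ∈ v.asIdeal → ρb.IsUnramifiedAt v) →
    -- (3a): good ordinary reduction at `3`
    (∀ v : HeightOneSpectrum (𝓞 ℚ), ((3 : ℕ) : 𝓞 ℚ) ∈ v.asIdeal →
      A.HasGoodOrdinaryReductionAt v) →
    -- (3b): the characteristic polynomial of Frobenius at `3` has no repeated roots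
    (∀ (ℓ : ℕ) [Fact ℓ.Prime], ℓ ≠ 3 →
      ∀ (b : Module.Basis (Fin 4) ℚ_[ℓ] (A.rationalTateModule ℓ))
        (r : FramedGaloisRep ℚ (PadicAlgCl ℓ) 4),
        (∀ g : Field.absoluteGaloisGroup ℚ,
          (r g).val =
            ((LinearMap.toMatrix b b (A.rationalTateRep ℓ g⁻¹)).map
              (algebraMap ℚ_[ℓ] (PadicAlgCl ℓ))).transpose) →
        ∀ v : HeightOneSpectrum (𝓞 ℚ), ((3 : ℕ) : 𝓞 ℚ) ∈ v.asIdeal →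
          r.IsUnramifiedAt v ∧
            ∀ Q : Polynomial (PadicAlgCl ℓ), r.HasFrobCharpolyAt v Q → Q.Separable) →
    -- (4): BAD reduction at `2`
    (∀ v : HeightOneSpectrum (𝓞 ℚ), ((2 : ℕ) : 𝓞 ℚ) ∈ v.asIdeal →
      ¬ HasGoodReductionAt A.X A.dim v) →
    -- conclusion: `A` is modular (`GL₄` almost-everywhere form)
    ∀ (p : ℕ) [Fact p.Prime] (b : Module.Basis (Fin 4) ℚ_[p] (A.rationalTateModule p))
      (r : FramedGaloisRep ℚ (PadicAlgCl p) 4),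
      (∀ g : Field.absoluteGaloisGroup ℚ,
        (r g).val =
          ((LinearMap.toMatrix b b (A.rationalTateRep p g⁻¹)).map
            (algebraMap ℚ_[p] (PadicAlgCl p))).transpose) →
      ∀ (hcpt : isCompact_glFiniteIntegralLevel 4 ℚ) (ι : PadicAlgCl p ≃+* ℂ),
        ∃ π : CuspidalAutomorphicRepData 4 ℚ hcpt, π.1.IsLAlgebraic ∧
          ∀ᶠ v : HeightOneSpectrum (𝓞 ℚ) in Filter.cofinite, ∃ a : Multiset ℂ,
            π.1.HasSatakeParamAt v a ∧ r.IsUnramifiedAt v ∧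
              r.HasFrobCharpolyAt v (arithFrobPolyOfSatake ι v.residueCard 1 a)

end Literature.NumberTheory.DiophantineGeometry
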